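import Summits.QuantumFields.BalabanUV.T4Continuum.Spine.NE2.CovariantTableBalabanTwoLevel
import Literature.MathematicalPhysics.QuantumFieldTheory.Balaban1983to89.T4AxialChain
import Literature.MathematicalPhysics.QuantumFieldTheory.Balaban1983to89.B9Eq373V3
import Mathlib.Data.Nat.Factorization.Basic

/-!
# T⁴ programme, spine node NE2 (U1a) — R14 W2, file 4: THE MEAN OF THE TWO-LEVEL WEIGHT OF BAŁABAN's COMPOSED TABLE — `(k+1)·L^{−k}` from sizes only
# (cell `pub-balaban-gaps`, seat ne2 gen 4; plan `run/shared/lean/pub/pub-balaban-gaps/ne/NE2-R14-PLAN.md` W2)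

File 3 (`CovariantTableBalabanTwoLevel.TBal_two_level_entry`) bounds the two-level entry difference of Bałaban's composed table by `thetaBal d L a c k ⌊t′/L⌋ = consBal + 2·tailBal`
(data consistency + sizes of the levels the carry cascade can move).  THIS FILE computes its MEAN over the line position:
 * §1 real bookkeeping (products of `(1 + x_i)^q` vs `e^{qΣx_i}` — `(1+x)^q ≤ e^{qx}` and `e^s − 1 ≤ s·e^s` BY NAME from `T4AxialChain` / `B9Eq373V3` —, geometric sums at ratio
   `L⁻¹ ≤ ½`, `(k+1)L^{−k} ≤ 2·(3/(2L))^k`);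
 * §2 **`sum_pow_padicValNat_le`**: `Σ_{t₀<L^k} L^{v_L(t₀+1)} ≤ (k+1)·L^k` (`Nat.card_multiples`: `L^{k−p}` of the positions have carry depth `≥ p`) — the COUNT behind the mean;
 * §3 under the per-level SIZE letter `a_i = α/L^i` (`sizeA`; (3.35) for the `(k−i)`-fold averaged field read on level `i`, lattice units) and the per-level CONSISTENCY letter
   `c_i = σθ_c^k/L^i` on `i ≤ k` (`consC`; the NE3-TYPE letter for the averaged fields of the level-`(k+1)` and level-`k` problems): **`tailBal_le`** (`≤ 2qαe^{2qα}·L^{v}·L^{−k}`,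
   `q = (d+1)L`), **`consBal_le`** (`≤ qσe^{qσ}θ_c^k`), **`theta_mean_TBal`**: `Σ_{ρ<L}Σ_{t′<L^{k+1}} thetaBal(⌊t′/L⌋) ≤ thetaMean·L·L^{k+1}` with
   `thetaMean = qσe^{qσ}θ_c^k + 4qαe^{2qα}(k+1)L^{−k}` — GEOMETRIC UP TO THE FACTOR `(k+1)` (the depth-`v` defect `O(αL^{v−k})` occurs at a fraction `L^{−v}` of the positions,
   `v = 0,…,k`; no cancellation between depths), and **`thetaMean_le_geom`**: `thetaMean ≤ thetaZero·ρ^k` for every `ρ ≥ max(θ_c, 3/(2L))`.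
File 5 (`ComposedAveragingRate`) turns this into the Gram-law `E`-datum of the composed table and the (3.26)-shape END at rate `ρ`.
HONEST FRAMING (T4-DAG p. 1).  Real-number bookkeeping about the weight of a TYPED table; `α`, `σ`, `θ_c` letters of DISPLAYED hypotheses asserted by nobody; nothing of [B7]
(15)/(124) constructed (DIVERGENCE F6 (ζ)); NOT NE2, NOT [B9] (3.16)/(3.26) as printed; NE2 (U1a) NOT PROVED; spine PROVED 0/9 unchanged; NOT continuum YM / infinite volume / mass
gap / Clay.  HONEST DEPENDENCY: continuum YM on T⁴ ⇐ BetaPertH ∧ nine spine estimates (0/9 proved); BetaPertH ⇐ (D1) ∧ (D4) ∧ CAP+tail; G-an2-4 gates asym, D1 and NE2/3/4.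
No `sorry`.
-/

noncomputable section

open scoped BigOperators
open Finset

namespace Summit.QuantumFields.BalabanUV.T4Continuum.NE2.ComposedAveragingMean

open Literature.MathematicalPhysics.QuantumFieldTheory.Balaban1983to89.B5G183RateUnitTower (lev)
open Literature.MathematicalPhysics.QuantumFieldTheory.Balaban1983to89.T4AxialChain (one_add_pow_le_exp)
open Literature.MathematicalPhysics.QuantumFieldTheory.Balaban1983to89.B9Eq373V3 (exp_sub_one_le_mul_exp_of_le)
open Summit.QuantumFields.BalabanUV.T4Continuum.BalabanAveragedTowerUnit (cast_lev')
open Summit.QuantumFields.BalabanUV.T4Continuum.NE2.CovariantTableBalabanTwoLevel (cutBal cutBal_le consBal tailBal thetaBal)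

variable {d : ℕ}

/-! ## §1 Real bookkeeping -/

/-- products `Π (1 + x_i)^q ≤ exp(q·Σ x_i)` (`x ≥ 0`). [folklore] -/
theorem list_prod_one_add_pow_le_exp (x : ℕ → ℝ) (hx : ∀ i, 0 ≤ x i) (q : ℕ) (l : List ℕ) :
    (l.map fun i => (1 + x i) ^ q).prod ≤ Real.exp (q * (l.map x).sum) := by
  induction l with
  | nil => simp
  | cons a l ih =>
    rw [List.map_cons, List.prod_cons, List.map_cons, List.sum_cons, mul_add, Real.exp_add]
    have h0 : 0 ≤ (l.map fun i => (1 + x i) ^ q).prod :=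
      List.prod_nonneg fun y hy => by obtain ⟨i, _, rfl⟩ := List.mem_map.mp hy; exact pow_nonneg (by linarith [hx i]) q
    exact mul_le_mul (one_add_pow_le_exp (hx a) q) ih h0 (Real.exp_pos _).le

/-- geometric sums at ratio `x ≤ ½`: `Σ_{i<n} x^i ≤ 2 − 2x^n ≤ 2`. [folklore] -/
theorem geom_sum_le_two {x : ℝ} (hx0 : 0 ≤ x) (hx : x ≤ 1 / 2) (n : ℕ) : ∑ i ∈ range n, x ^ i ≤ 2 - 2 * x ^ n := by
  induction n with
  | zero => simp
  | succ n ih =>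
    rw [Finset.sum_range_succ, pow_succ]
    have hxn : 0 ≤ x ^ n := pow_nonneg hx0 n
    nlinarith

/-- `L⁻¹ ≤ ½` and `0 ≤ L⁻¹` for `L ≥ 2`. [folklore] -/
theorem inv_le_half {L : ℕ} (hL : 2 ≤ L) : (0 : ℝ) ≤ (L : ℝ)⁻¹ ∧ (L : ℝ)⁻¹ ≤ 1 / 2 := by
  have hL' : (2 : ℝ) ≤ L := by exact_mod_cast hL
  refine ⟨inv_nonneg.mpr (by linarith), ?_⟩
  rw [one_div]; exact inv_anti₀ (by norm_num) hL'

/-- `Σ_{i<n} α·L^{−(m+i+1)} ≤ 2α·L^{−(m+1)}` (`L ≥ 2`, `α ≥ 0`). [folklore] -/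
theorem sum_shifted_geom_le {L : ℕ} (hL : 2 ≤ L) {α : ℝ} (hα : 0 ≤ α) (m n : ℕ) :
    ((List.range n).map fun i => α * ((L : ℝ)⁻¹) ^ (m + i + 1)).sum ≤ 2 * α * ((L : ℝ)⁻¹) ^ (m + 1) := by
  obtain ⟨h0, h2⟩ := inv_le_half hL
  have e : ((List.range n).map fun i => α * ((L : ℝ)⁻¹) ^ (m + i + 1)).sum = α * ((L : ℝ)⁻¹) ^ (m + 1) * ∑ i ∈ range n, ((L : ℝ)⁻¹) ^ i := by
    rw [← List.sum_toFinset _ List.nodup_range, List.toFinset_range, Finset.mul_sum]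
    refine Finset.sum_congr rfl fun i _ => ?_
    rw [show m + i + 1 = (m + 1) + i by ring, pow_add]; ring
  rw [e]
  have hg := geom_sum_le_two h0 h2 n
  have hxn : 0 ≤ ((L : ℝ)⁻¹) ^ n := pow_nonneg h0 n
  have hp : 0 ≤ α * ((L : ℝ)⁻¹) ^ (m + 1) := mul_nonneg hα (pow_nonneg h0 _)
  nlinarith

/-- `(k+1)·L^{−k} ≤ 2·(3/(2L))^k` — the factor `(k+1)` costs at most the rate `3/(2L)` (`< 1` for `L ≥ 2`). [folklore] -/
theorem succ_mul_invPow_le (L : ℕ) (hL : 1 ≤ L) (k : ℕ) : ((k : ℝ) + 1) * ((L : ℝ)⁻¹) ^ k ≤ 2 * (3 / (2 * (L : ℝ))) ^ k := by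
  have hLr : (0 : ℝ) < L := by exact_mod_cast hL
  have hk : ((k : ℝ) + 1) ≤ 2 * (3 / 2 : ℝ) ^ k := by
    induction k with
    | zero => norm_num
    | succ k ih =>
      push_cast
      have h1 : (1 : ℝ) ≤ (3 / 2 : ℝ) ^ k := one_le_pow₀ (by norm_num)
      rw [pow_succ]; nlinarith
  have e : (3 / (2 * (L : ℝ))) ^ k = (3 / 2 : ℝ) ^ k * ((L : ℝ)⁻¹) ^ k := by rw [← mul_pow]; congr 1; field_simp
  rw [e, ← mul_assoc]
  exact mul_le_mul_of_nonneg_right hk (pow_nonneg (inv_nonneg.mpr hLr.le) k)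

/-! ## §2 The count behind the mean: positions of carry depth `≥ p` -/

/-- for `t₀ < L^k` the carry depth is `≤ k` (`L ≥ 2`). [folklore] -/
theorem padicValNat_succ_le {L : ℕ} (hL : 2 ≤ L) {k t₀ : ℕ} (ht : t₀ < L ^ k) : padicValNat L (t₀ + 1) ≤ k := by
  have h1 : L ^ padicValNat L (t₀ + 1) ∣ t₀ + 1 := pow_padicValNat_dvd
  have h2 : L ^ padicValNat L (t₀ + 1) ≤ L ^ k := (Nat.le_of_dvd (Nat.succ_pos _) h1).trans (by omega)
  exact (Nat.pow_le_pow_iff_right (by omega)).mp h2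

/-- **THE COUNT**: `Σ_{t₀<L^k} L^{v_L(t₀+1)} ≤ (k+1)·L^k` — `L^{k−p}` of the `L^k` positions have depth `≥ p` (`Nat.card_multiples`), `p = 0,…,k`. [folklore] -/
theorem sum_pow_padicValNat_le {L : ℕ} (hL : 2 ≤ L) (k : ℕ) :
    ∑ t₀ ∈ range (L ^ k), L ^ padicValNat L (t₀ + 1) ≤ (k + 1) * L ^ k := by
  calc ∑ t₀ ∈ range (L ^ k), L ^ padicValNat L (t₀ + 1)
      ≤ ∑ t₀ ∈ range (L ^ k), ∑ p ∈ range (k + 1), (if L ^ p ∣ t₀ + 1 then L ^ p else 0) := by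
        refine Finset.sum_le_sum fun t₀ ht₀ => ?_
        rw [Finset.mem_range] at ht₀
        have hv := padicValNat_succ_le hL ht₀
        have hmem : padicValNat L (t₀ + 1) ∈ range (k + 1) := Finset.mem_range.mpr (by omega)
        refine (Finset.single_le_sum (f := fun p => if L ^ p ∣ t₀ + 1 then L ^ p else 0) (fun p _ => Nat.zero_le _) hmem).trans' ?_
        simp only [pow_padicValNat_dvd, if_true, le_refl]
    _ = ∑ p ∈ range (k + 1), ∑ t₀ ∈ range (L ^ k), (if L ^ p ∣ t₀ + 1 then L ^ p else 0) := Finset.sum_comm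
    _ = ∑ p ∈ range (k + 1), L ^ p * (L ^ k / L ^ p) := by
        refine Finset.sum_congr rfl fun p _ => ?_
        rw [← Finset.sum_filter, Finset.sum_const, smul_eq_mul, Nat.card_multiples, mul_comm]
    _ ≤ ∑ _p ∈ range (k + 1), L ^ k := Finset.sum_le_sum fun p _ => Nat.mul_div_le (L ^ k) (L ^ p)
    _ = (k + 1) * L ^ k := by rw [Finset.sum_const, Finset.card_range, smul_eq_mul]

/-- `Σ_{t′<L·n} f(⌊t′/L⌋) = L·Σ_{t<n} f(t)` (every coarse position has `L` fine preimages). [folklore] -/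
theorem sum_range_mul_div {β : Type*} [AddCommMonoid β] (L : ℕ) (hL : 0 < L) (f : ℕ → β) (n : ℕ) :
    ∑ t' ∈ range (L * n), f (t' / L) = L • ∑ t ∈ range n, f t := by
  induction n with
  | zero => simp
  | succ n ih =>
    rw [Nat.mul_succ, Finset.sum_range_add, ih, Finset.sum_range_succ, smul_add]
    congr 1
    have e : ∀ x ∈ range L, f ((L * n + x) / L) = f n := fun x hx => by
      rw [Finset.mem_range] at hx
      congr 1
      rw [show L * n + x = x + L * n by ring, Nat.add_mul_div_left _ _ hL, Nat.div_eq_of_lt hx, zero_add]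
    rw [Finset.sum_congr rfl e, Finset.sum_const, Finset.card_range]

/-! ## §3 The weight of the composed table under (3.35)-type sizes and NE3-type consistency, and its mean -/

section Data

variable (L : ℕ) [NeZero L] (M : Fin d → ℕ) [hM : ∀ μ, NeZero (M μ)] {o : Type*} [Fintype o] [DecidableEq o] [Nonempty o]

/-- the per-level SIZE letter `a_i = α/L^i` ((3.35) for the averaged field read on level `i`, lattice units). [folklore] -/
def sizeA (L : ℕ) (α : ℝ) (i : ℕ) : ℝ := α * ((L : ℝ)⁻¹) ^ i

/-- the per-level CONSISTENCY letter of the level-`(k+1)` vs level-`k` problem: `σθ_c^k/L^i` on the levels `i ≤ k` of the `k`-chain, the trivial `2` beyond. [folklore] -/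
def consC (L : ℕ) (σ θc : ℝ) (k i : ℕ) : ℝ := if i ≤ k then σ * θc ^ k * ((L : ℝ)⁻¹) ^ i else 2

omit [NeZero L] in
/-- `sizeA ≥ 0`. [folklore] -/
theorem sizeA_nonneg {α : ℝ} (hα : 0 ≤ α) (i : ℕ) : 0 ≤ sizeA L α i := by
  unfold sizeA; exact mul_nonneg hα (pow_nonneg (inv_nonneg.mpr (Nat.cast_nonneg L)) i)

omit [NeZero L] in
/-- `consC ≥ 0`. [folklore] -/
theorem consC_nonneg {σ θc : ℝ} (hσ : 0 ≤ σ) (hθ : 0 ≤ θc) (k i : ℕ) : 0 ≤ consC L σ θc k i := by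
  unfold consC; split_ifs
  · exact mul_nonneg (mul_nonneg hσ (pow_nonneg hθ k)) (pow_nonneg (inv_nonneg.mpr (Nat.cast_nonneg L)) i)
  · norm_num

omit [NeZero L] in
/-- **THE CASCADE PART UNDER (3.35)-TYPE SIZES**: `tailBal d L a k t₀ ≤ 2qα·e^{2qα}·L^{v_L(t₀+1)}·L^{−k}` for `t₀ < L^k` (`q = (d+1)L`): the levels the cascade can move
start at `cutBal + 1 ≥ k − v`, their sizes sum to `≤ 2αL^{v−k}`. [folklore] -/
theorem tailBal_le (hL : 2 ≤ L) {α : ℝ} (hα : 0 ≤ α) {k t₀ : ℕ} (ht : t₀ < L ^ k) :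
    tailBal d L (sizeA L α) k t₀
      ≤ 2 * (((d + 1) * L : ℕ) : ℝ) * α * Real.exp (2 * (((d + 1) * L : ℕ) : ℝ) * α) * ((L : ℝ) ^ padicValNat L (t₀ + 1) * ((L : ℝ)⁻¹) ^ k) := by
  obtain ⟨h0, h2⟩ := inv_le_half hL
  have hLr : (0 : ℝ) < L := by exact_mod_cast (by omega : 0 < L)
  set q : ℕ := (d + 1) * L with hq
  set m := cutBal L k t₀ with hm
  set v := padicValNat L (t₀ + 1) with hv
  have hvk : v ≤ k := padicValNat_succ_le hL ht
  have hmk : m ≤ k := cutBal_le L k t₀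
  -- the sizes of the movable levels sum to `≤ 2α L^{−(m+1)}`
  set s : ℝ := ((List.range (k + 1 - m)).map fun i => sizeA L α (m + i + 1)).sum with hs
  have hs_le : s ≤ 2 * α * ((L : ℝ)⁻¹) ^ (m + 1) := by
    have e : ((List.range (k + 1 - m)).map fun i => sizeA L α (m + i + 1)) = (List.range (k + 1 - m)).map fun i => α * ((L : ℝ)⁻¹) ^ (m + i + 1) := rfl
    rw [hs, e]; exact sum_shifted_geom_le hL hα m _
  have hs0 : 0 ≤ s := List.sum_nonneg fun y hy => by obtain ⟨i, _, rfl⟩ := List.mem_map.mp hy; exact sizeA_nonneg L hα _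
  -- `L^{−(m+1)} ≤ L^{v}·L^{−k}`
  have hgeo : ((L : ℝ)⁻¹) ^ (m + 1) ≤ (L : ℝ) ^ v * ((L : ℝ)⁻¹) ^ k := by
    have hkm : k - v ≤ m + 1 := by rw [hm]; unfold cutBal; omega
    have e : (L : ℝ) ^ v * ((L : ℝ)⁻¹) ^ k = ((L : ℝ)⁻¹) ^ (k - v) := by
      rw [show k = v + (k - v) by omega, pow_add, Nat.add_sub_cancel_left, ← mul_assoc, ← mul_pow, mul_inv_cancel₀ hLr.ne', one_pow, one_mul]
    rw [e]
    exact pow_le_pow_of_le_one h0 (by linarith) hkm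
  have hx1 : ((L : ℝ)⁻¹) ^ (m + 1) ≤ 1 := pow_le_one₀ h0 (by linarith)
  -- assemble
  have hprod := list_prod_one_add_pow_le_exp (sizeA L α) (sizeA_nonneg L hα) q ((List.range (k + 1 - m)).map fun i => m + i + 1)
  rw [List.map_map, List.map_map] at hprod
  have hprod' : ((List.range (k + 1 - m)).map fun i' => (1 + sizeA L α (m + i' + 1)) ^ q).prod ≤ Real.exp (q * s) := hprod
  have hqs : (q : ℝ) * s ≤ 2 * q * α * ((L : ℝ)⁻¹) ^ (m + 1) := by nlinarith [Nat.cast_nonneg (α := ℝ) q]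
  have hqs1 : (q : ℝ) * s ≤ 2 * q * α := hqs.trans (mul_le_of_le_one_right (by positivity) hx1)
  unfold tailBal
  rw [← hm]
  calc ((List.range (k + 1 - m)).map fun i' => (1 + sizeA L α (m + i' + 1)) ^ q).prod - 1
      ≤ Real.exp (q * s) - 1 := by linarith
    _ ≤ (q * s) * Real.exp (q * s) := exp_sub_one_le_mul_exp_of_le (by positivity) le_rfl
    _ ≤ (2 * q * α * ((L : ℝ)⁻¹) ^ (m + 1)) * Real.exp (2 * q * α) :=
        mul_le_mul hqs (Real.exp_le_exp.mpr hqs1) (Real.exp_pos _).le (by positivity)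
    _ ≤ (2 * q * α * ((L : ℝ) ^ v * ((L : ℝ)⁻¹) ^ k)) * Real.exp (2 * q * α) := by gcongr
    _ = _ := by ring

omit [NeZero L] in
/-- **THE CONSISTENCY PART UNDER THE NE3-TYPE LETTER**: `consBal d L (consC L σ θ_c k) k ≤ qσe^{qσ}·θ_c^k` (`0 ≤ θ_c ≤ 1`, `q = (d+1)L`). [folklore] -/
theorem consBal_le (hL : 2 ≤ L) {σ θc : ℝ} (hσ : 0 ≤ σ) (hθ0 : 0 ≤ θc) (hθ1 : θc ≤ 1) (k : ℕ) :
    consBal d L (consC L σ θc k) k ≤ (((d + 1) * L : ℕ) : ℝ) * σ * Real.exp ((((d + 1) * L : ℕ) : ℝ) * σ) * θc ^ k := by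
  obtain ⟨h0, h2⟩ := inv_le_half hL
  set q : ℕ := (d + 1) * L with hq
  have hq0 : (0 : ℝ) ≤ q := Nat.cast_nonneg q
  have hθk : θc ^ k ≤ 1 := pow_le_one₀ hθ0 hθ1
  have hθk0 : 0 ≤ θc ^ k := pow_nonneg hθ0 k
  -- each term: `(1 + σθ^k x)^q − 1 ≤ qσθ^k x · e^{qσ}`, `x = L^{−(i'+1)} ≤ 1`
  have hterm : ∀ i' ∈ List.range k, (1 + consC L σ θc k (i' + 1)) ^ q - 1 ≤ (q * σ * Real.exp (q * σ) * θc ^ k) * ((L : ℝ)⁻¹) ^ (i' + 1) := by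
    intro i' hi'
    rw [List.mem_range] at hi'
    have hc : consC L σ θc k (i' + 1) = σ * θc ^ k * ((L : ℝ)⁻¹) ^ (i' + 1) := by unfold consC; rw [if_pos (by omega)]
    rw [hc]
    set x := ((L : ℝ)⁻¹) ^ (i' + 1) with hx
    have hx0 : 0 ≤ x := pow_nonneg h0 _
    have hx1 : x ≤ 1 := pow_le_one₀ h0 (by linarith)
    have hy0 : 0 ≤ σ * θc ^ k * x := by positivity
    have hqy : (q : ℝ) * (σ * θc ^ k * x) ≤ q * σ := by
      have : σ * θc ^ k * x ≤ σ := by nlinarith [mul_le_one₀ hθk hx0 hx1]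
      nlinarith
    calc (1 + σ * θc ^ k * x) ^ q - 1 ≤ Real.exp (q * (σ * θc ^ k * x)) - 1 := by linarith [one_add_pow_le_exp hy0 q]
      _ ≤ (q * (σ * θc ^ k * x)) * Real.exp (q * (σ * θc ^ k * x)) := exp_sub_one_le_mul_exp_of_le (by positivity) le_rfl
      _ ≤ (q * (σ * θc ^ k * x)) * Real.exp (q * σ) := mul_le_mul_of_nonneg_left (Real.exp_le_exp.mpr hqy) (by positivity)
      _ = _ := by ring
  unfold consBal
  calc ((List.range k).map fun i' => (1 + consC L σ θc k (i' + 1)) ^ q - 1).sum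
      ≤ ((List.range k).map fun i' => (q * σ * Real.exp (q * σ) * θc ^ k) * ((L : ℝ)⁻¹) ^ (i' + 1)).sum := List.sum_le_sum hterm
    _ = (q * σ * Real.exp (q * σ) * θc ^ k) * ∑ i ∈ range k, ((L : ℝ)⁻¹) ^ (i + 1) := by
        rw [← List.sum_toFinset _ List.nodup_range, List.toFinset_range, Finset.mul_sum]
    _ ≤ (q * σ * Real.exp (q * σ) * θc ^ k) * 1 := by
        refine mul_le_mul_of_nonneg_left ?_ (by positivity)
        have hg := geom_sum_le_two h0 h2 k
        have e : ∑ i ∈ range k, ((L : ℝ)⁻¹) ^ (i + 1) = (L : ℝ)⁻¹ * ∑ i ∈ range k, ((L : ℝ)⁻¹) ^ i := by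
          rw [Finset.mul_sum]; exact Finset.sum_congr rfl fun i _ => by rw [pow_succ]; ring
        rw [e]
        nlinarith [pow_nonneg h0 k]
    _ = _ := by ring

/-- the MEAN two-level consistency of the composed table: `θ_k = qσe^{qσ}θ_c^k + 4qαe^{2qα}(k+1)L^{−k}`, `q = (d+1)L`. [folklore] -/
def thetaMean (d L : ℕ) (α σ θc : ℝ) (k : ℕ) : ℝ :=
  (((d + 1) * L : ℕ) : ℝ) * σ * Real.exp ((((d + 1) * L : ℕ) : ℝ) * σ) * θc ^ k
    + 4 * (((d + 1) * L : ℕ) : ℝ) * α * Real.exp (2 * (((d + 1) * L : ℕ) : ℝ) * α) * (((k : ℝ) + 1) * ((L : ℝ)⁻¹) ^ k)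

/-- the geometric majorant `θ₀ = qσe^{qσ} + 8qαe^{2qα}`. [folklore] -/
def thetaZero (d L : ℕ) (α σ : ℝ) : ℝ :=
  (((d + 1) * L : ℕ) : ℝ) * σ * Real.exp ((((d + 1) * L : ℕ) : ℝ) * σ) + 8 * (((d + 1) * L : ℕ) : ℝ) * α * Real.exp (2 * (((d + 1) * L : ℕ) : ℝ) * α)

omit [NeZero L] in
/-- `thetaMean ≥ 0`. [folklore] -/
theorem thetaMean_nonneg {α σ θc : ℝ} (hα : 0 ≤ α) (hσ : 0 ≤ σ) (hθ : 0 ≤ θc) (k : ℕ) : 0 ≤ thetaMean d L α σ θc k := by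
  unfold thetaMean
  have h0 : (0 : ℝ) ≤ (L : ℝ)⁻¹ := inv_nonneg.mpr (Nat.cast_nonneg L)
  positivity

omit [NeZero L] in
/-- **GEOMETRIC MAJORANT**: `θ_k ≤ θ₀·ρ^k` for every `ρ ≥ max(θ_c, 3/(2L))` (`L ≥ 1`). [folklore] -/
theorem thetaMean_le_geom (hL : 1 ≤ L) {α σ θc ρ : ℝ} (hα : 0 ≤ α) (hσ : 0 ≤ σ) (hθ : 0 ≤ θc) (hθρ : θc ≤ ρ) (hρ : 3 / (2 * (L : ℝ)) ≤ ρ) (k : ℕ) :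
    thetaMean d L α σ θc k ≤ thetaZero d L α σ * ρ ^ k := by
  have h3 : (0 : ℝ) ≤ 3 / (2 * (L : ℝ)) := by positivity
  have hk := succ_mul_invPow_le L hL k
  have hρk : (3 / (2 * (L : ℝ))) ^ k ≤ ρ ^ k := pow_le_pow_left₀ h3 hρ k
  have hθk : θc ^ k ≤ ρ ^ k := pow_le_pow_left₀ hθ hθρ k
  unfold thetaMean thetaZero
  have hA : 0 ≤ (((d + 1) * L : ℕ) : ℝ) * σ * Real.exp ((((d + 1) * L : ℕ) : ℝ) * σ) := by positivity
  have hB : 0 ≤ 4 * (((d + 1) * L : ℕ) : ℝ) * α * Real.exp (2 * (((d + 1) * L : ℕ) : ℝ) * α) := by positivity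
  nlinarith [mul_le_mul_of_nonneg_left hθk hA, mul_le_mul_of_nonneg_left (hk.trans (mul_le_mul_of_nonneg_left hρk zero_le_two)) hB]

omit [NeZero L] hM [DecidableEq o] in
/-- **THE MEAN OF THE TWO-LEVEL WEIGHT OF THE COMPOSED TABLE**: with sizes `sizeA` and consistency `consC`,
`Σ_{ρ<L} Σ_{t′<L·L^k} thetaBal d L sizeA (consC k) k ⌊t′/L⌋ ≤ thetaMean·(L·(L·L^k))` (`L ≥ 2`). [folklore] -/
theorem theta_mean_TBal (hL : 2 ≤ L) {α σ θc : ℝ} (hα : 0 ≤ α) (hσ : 0 ≤ σ) (hθ0 : 0 ≤ θc) (hθ1 : θc ≤ 1) (k : ℕ) :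
    ∑ _ρ : Fin L, ∑ t' : Fin (L * lev L k), thetaBal d L (sizeA L α) (consC L σ θc k) k ((t' : ℕ) / L)
      ≤ thetaMean d L α σ θc k * (L * (L * lev L k)) := by
  have hL0 : 0 < L := by omega
  have hLr : (0 : ℝ) < L := by exact_mod_cast hL0
  have hlev : lev L k = L ^ k := by
    have h := cast_lev' (L := L) k
    exact_mod_cast h
  set q : ℕ := (d + 1) * L with hq
  set Kc : ℝ := (q : ℝ) * σ * Real.exp (q * σ) * θc ^ k with hKc
  set Ka : ℝ := 2 * (q : ℝ) * α * Real.exp (2 * q * α) with hKa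
  have hKa0 : 0 ≤ Ka := by positivity
  -- pointwise bound on `range (L^k)`
  have hpt : ∀ t₀ ∈ range (L ^ k), thetaBal d L (sizeA L α) (consC L σ θc k) k t₀
      ≤ Kc + 2 * (Ka * ((L : ℝ) ^ padicValNat L (t₀ + 1) * ((L : ℝ)⁻¹) ^ k)) := by
    intro t₀ ht₀
    rw [Finset.mem_range] at ht₀
    unfold thetaBal
    exact add_le_add (consBal_le L hL hσ hθ0 hθ1 k) (mul_le_mul_of_nonneg_left (tailBal_le L hL hα ht₀) zero_le_two)
  -- sum over the coarse positions
  have hsum : ∑ t₀ ∈ range (L ^ k), thetaBal d L (sizeA L α) (consC L σ θc k) k t₀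
      ≤ (L : ℝ) ^ k * Kc + 2 * Ka * (((k : ℝ) + 1) * ((L : ℝ)⁻¹) ^ k * (L : ℝ) ^ k) := by
    have hcount : ∑ t₀ ∈ range (L ^ k), (L : ℝ) ^ padicValNat L (t₀ + 1) ≤ ((k : ℝ) + 1) * (L : ℝ) ^ k := by
      have h := sum_pow_padicValNat_le hL k
      exact_mod_cast h
    calc ∑ t₀ ∈ range (L ^ k), thetaBal d L (sizeA L α) (consC L σ θc k) k t₀
        ≤ ∑ t₀ ∈ range (L ^ k), (Kc + 2 * (Ka * ((L : ℝ) ^ padicValNat L (t₀ + 1) * ((L : ℝ)⁻¹) ^ k))) := Finset.sum_le_sum hpt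
      _ = (L ^ k : ℕ) * Kc + 2 * Ka * ((L : ℝ)⁻¹) ^ k * ∑ t₀ ∈ range (L ^ k), (L : ℝ) ^ padicValNat L (t₀ + 1) := by
          rw [Finset.sum_add_distrib, Finset.sum_const, Finset.card_range, nsmul_eq_mul, Finset.mul_sum]
          congr 1
          exact Finset.sum_congr rfl fun t₀ _ => by ring
      _ ≤ (L ^ k : ℕ) * Kc + 2 * Ka * ((L : ℝ)⁻¹) ^ k * (((k : ℝ) + 1) * (L : ℝ) ^ k) := by
          gcongr
      _ = _ := by push_cast; ring
  -- lift to the fine positions and the (irrelevant) sub-block offset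
  have hfine : ∑ t' : Fin (L * lev L k), thetaBal d L (sizeA L α) (consC L σ θc k) k ((t' : ℕ) / L)
      = (L : ℝ) * ∑ t₀ ∈ range (L ^ k), thetaBal d L (sizeA L α) (consC L σ θc k) k t₀ := by
    rw [Fin.sum_univ_eq_sum_range (fun t' => thetaBal d L (sizeA L α) (consC L σ θc k) k (t' / L)) (L * lev L k), hlev,
      sum_range_mul_div L hL0, nsmul_eq_mul]
  rw [Finset.sum_const, Finset.card_univ, Fintype.card_fin, nsmul_eq_mul, hfine]
  have hmean : thetaMean d L α σ θc k = Kc + 2 * Ka * (((k : ℝ) + 1) * ((L : ℝ)⁻¹) ^ k) := by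
    rw [thetaMean, hKc, hKa, hq]; ring
  rw [hmean, hlev]; push_cast
  have h2 := mul_le_mul_of_nonneg_left hsum (by positivity : (0 : ℝ) ≤ (L : ℝ) * L)
  calc (L : ℝ) * ((L : ℝ) * ∑ t₀ ∈ range (L ^ k), thetaBal d L (sizeA L α) (consC L σ θc k) k t₀)
      = (L : ℝ) * L * ∑ t₀ ∈ range (L ^ k), thetaBal d L (sizeA L α) (consC L σ θc k) k t₀ := by ring
    _ ≤ (L : ℝ) * L * ((L : ℝ) ^ k * Kc + 2 * Ka * (((k : ℝ) + 1) * ((L : ℝ)⁻¹) ^ k * (L : ℝ) ^ k)) := h2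
    _ = (Kc + 2 * Ka * (((k : ℝ) + 1) * ((L : ℝ)⁻¹) ^ k)) * ((L : ℝ) * ((L : ℝ) * (L : ℝ) ^ k)) := by ring

end Data

end Summit.QuantumFields.BalabanUV.T4Continuum.NE2.ComposedAveragingMean

end
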